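import Mathlib

/-!
# `DependentTripleAtThree` — the homological shadow of a dependent triple: it obstructs only in type `(3;0,0,0)`, never for a homotopy sphere

Negative lane of crux `WeakReductionDescent.DependentTripleAtThree` (item stmt-SmoothPoincare4-17999,
route `route-SmoothPoincare4-WeakReductionDescent`), seat refuter-cdisprove-stmt-SmoothPoincare4-17999-0,
2026-08-17 (crux workfile `Cruxes/DependentTripleAtThree/Disproof.lean`, §2).  Small-model facts about
the LOAD-BEARING hypothesis `e : M ≃ₕ S⁴` of the crux; no statement here concludes a route item.

DICTIONARY (Feller–Klug–Schirmer–Zemke, arXiv:1711.04762, §2; Aranda–Zupan arXiv:2503.04607 p. 2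
L27–29).  Let `(Σ₃; α, β, γ)` be a diagram of a genus-`3` GK-trisection with handlebodies
`H_α, H_β, H_γ`, and fix a symplectic basis `e₀,…,e₅` of `H₁(Σ₃; ℤ) ≅ ℤ⁶` (pairs `(e₀,e₁)`,
`(e₂,e₃)`, `(e₄,e₅)`), so that the intersection form is
`⟪u, v⟫ = (u₀v₁ − u₁v₀) + (u₂v₃ − u₃v₂) + (u₄v₅ − u₅v₄)`.  A curve bounding a disc in `H_α` has its
class in the Lagrangian `L_α = ker (H₁(Σ₃) → H₁(H_α))`, likewise `L_β`, `L_γ`; DISJOINT curves have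
`⟪·,·⟫ = 0`; a NON-SEPARATING simple closed curve has NONZERO class; and for pairwise disjoint
simple closed curves "`Σ ∖ (a ∪ b ∪ c)` disconnected" (the crux's `¬ IsPreconnected (F \ (a ∪ b ∪ c))`)
is "`[a], [b], [c]` linearly dependent".  So a dependent triple of the crux casts the SHADOW

  `∃ a ∈ L_α, b ∈ L_β, c ∈ L_γ`, all `≠ 0`, pairwise `⟪·,·⟫ = 0`, `ℤ`-linearly dependent,

stated below over `Fin 6 → ℤ` with the three Lagrangians as explicit sets (no new definitions).

* `shadowTriple_false_threeCP2` — for the minimal `(3;0,0,0)` trisection of `#³ℂP²` (three copies of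
  the genus-`1` diagram of `ℂP²`, slopes `0, ∞, 1`: `L_α = ⟨e₀,e₂,e₄⟩`, `L_β = ⟨e₁,e₃,e₅⟩`,
  `L_γ = ⟨e₀+e₁, e₂+e₃, e₄+e₅⟩`) the shadow does NOT exist: `⟪a, c⟫ = Σ a₂ᵢ c₂ᵢ`, and a relation
  `l a + m b + n c = 0` forces `n c₂ᵢ = −l a₂ᵢ`, whence `l · Σ a₂ᵢ² = 0`; every branch ends in
  `a = 0`, `b = 0` or `c = 0`.  This is the kernel-checked core of the refuters' finding that the
  crux WITHOUT its hypothesis `e : M ≃ₕ S⁴` is false in kind (`#³ℂP²` has trisection genus `3`,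
  Chu–Tillmann `g ≥ χ − 2 + 3 rk π₁ = 3`, and its genus-`3` trisection admits no dependent triple;
  consistent with AZ25 Thm 1.4, which lists `#³ℂP²` among the manifolds a dependent triple ALLOWS
  but does not force one).  The passage curve ↦ class is not formalised in the tree, so the
  manifold-level `_false_without_e` stays a paper witness; its arithmetic is here.
* `shadowTriple_of_common_class` — NO such obstruction exists as soon as ONE pairwise Lagrangian
  intersection is nonzero: a common nonzero class `a ∈ L_α ∩ L_β` and two independent classes of
  `L_γ` give the shadow `(a, a, c)` with `c ∈ L_γ ∩ a^⟂` (AZ25 §7 case (1), "two curves parallel").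
  For a `(3; k₀,k₁,k₂)` trisection `rk (L_α ∩ L_β)` is the `k` of the sector bounded by
  `H_α ∪ H_β` (`H₂(#ᵏ S¹×S²) = ℤᵏ`), so the shadow is unobstructed unless `k = (0,0,0)`, i.e.
  `χ = 5`: for a homotopy 4-sphere (`χ = 2`, `Σ kᵢ = 3`, tree theorem
  `gkTrisection_genus_eq_sum_of_homotopyEquiv_sphere`) homology can never refute the crux's
  conclusion, and any proof or disproof of it must be GEOMETRIC (disc sets), as AZ25 §7–8 is.
* `shadowTriple_sphere_threeOneOneOne` — the instance for the Lagrangians of the standard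
  `(3;1,1,1)` trisection of `S⁴` (sum of the three unbalanced genus-`1` stabilisations:
  `L_α = ⟨e₀,e₃,e₄⟩`, `L_β = ⟨e₀,e₂,e₅⟩`, `L_γ = ⟨e₁,e₂,e₄⟩`, pairwise intersections of rank `1`,
  sum `ℤ⁶`).

Primitivity of the classes (automatic for simple closed curves) is not demanded: dropping it only
strengthens `shadowTriple_false_threeCP2`, and in `shadowTriple_of_common_class` one may divide `c`
by the gcd of its coefficients inside the pure subgroup `L_γ`.
-/

-- the registered namespace `Summit.SmoothPoincare4.SmoothPoincare4.Theorems` repeats a component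
set_option linter.dupNamespace false

namespace Summit.SmoothPoincare4.SmoothPoincare4.Theorems.DependentTripleAtThree.Negative

/-- **No homological shadow of a dependent triple for the `(3;0,0,0)` trisection of `#³ℂP²`.**
With `L_α = {a | a₁ = a₃ = a₅ = 0}`, `L_β = {b | b₀ = b₂ = b₄ = 0}`,
`L_γ = {c | c₁ = c₀, c₃ = c₂, c₅ = c₄}` (slopes `0, ∞, 1` on each torus summand) there are no
nonzero `a ∈ L_α`, `b ∈ L_β`, `c ∈ L_γ`, pairwise orthogonal for the intersection form
`⟪u, v⟫ = (u₀v₁ − u₁v₀) + (u₂v₃ − u₃v₂) + (u₄v₅ − u₅v₄)`, that are `ℤ`-linearly dependent.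
Hence the genus-`3` trisection of `#³ℂP²` admits no dependent triple, and the crux without
`e : M ≃ₕ S⁴` is false in kind. [folklore] -/
theorem shadowTriple_false_threeCP2 :
    ¬ ∃ a b c : Fin 6 → ℤ,
        (a 1 = 0 ∧ a 3 = 0 ∧ a 5 = 0) ∧ (b 0 = 0 ∧ b 2 = 0 ∧ b 4 = 0) ∧
        (c 1 = c 0 ∧ c 3 = c 2 ∧ c 5 = c 4) ∧ a ≠ 0 ∧ b ≠ 0 ∧ c ≠ 0 ∧
        a 0 * b 1 - a 1 * b 0 + (a 2 * b 3 - a 3 * b 2) + (a 4 * b 5 - a 5 * b 4) = 0 ∧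
        b 0 * c 1 - b 1 * c 0 + (b 2 * c 3 - b 3 * c 2) + (b 4 * c 5 - b 5 * c 4) = 0 ∧
        a 0 * c 1 - a 1 * c 0 + (a 2 * c 3 - a 3 * c 2) + (a 4 * c 5 - a 5 * c 4) = 0 ∧
        ∃ l m n : ℤ, ¬ (l = 0 ∧ m = 0 ∧ n = 0) ∧ l • a + m • b + n • c = 0 := by
  rintro ⟨a, b, c, ⟨ha1, ha3, ha5⟩, ⟨hb0, hb2, hb4⟩, ⟨hc1, hc3, hc5⟩, ha, hb, hc, -, -, hac,
    l, m, n, hlmn, hrel⟩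
  have h : ∀ i, l * a i + m * b i + n * c i = 0 := fun i => by
    simpa only [Pi.add_apply, Pi.smul_apply, smul_eq_mul, Pi.zero_apply] using congr_fun hrel i
  have h0 := h 0; have h1 := h 1; have h2 := h 2; have h3 := h 3; have h4 := h 4; have h5 := h 5
  rw [ha1, ha3, ha5, hc1, hc3, hc5] at hac
  rw [hb0] at h0; rw [hb2] at h2; rw [hb4] at h4
  rw [ha1, hc1] at h1; rw [ha3, hc3] at h3; rw [ha5, hc5] at h5
  have key : l * (a 0 ^ 2 + a 2 ^ 2 + a 4 ^ 2) = 0 := by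
    linear_combination (a 0) * h0 + (a 2) * h2 + (a 4) * h4 - n * hac
  rcases mul_eq_zero.mp key with hl | hsq
  · subst hl
    by_cases hn : n = 0
    · subst hn
      have hm : m ≠ 0 := fun hm => hlmn ⟨rfl, hm, rfl⟩
      have hb1 : b 1 = 0 := (mul_eq_zero.mp (by linarith : m * b 1 = 0)).resolve_left hm
      have hb3 : b 3 = 0 := (mul_eq_zero.mp (by linarith : m * b 3 = 0)).resolve_left hm
      have hb5 : b 5 = 0 := (mul_eq_zero.mp (by linarith : m * b 5 = 0)).resolve_left hm
      exact hb (funext fun i => by fin_cases i <;> assumption)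
    · have hc0 : c 0 = 0 := (mul_eq_zero.mp (by linarith : n * c 0 = 0)).resolve_left hn
      have hc2 : c 2 = 0 := (mul_eq_zero.mp (by linarith : n * c 2 = 0)).resolve_left hn
      have hc4 : c 4 = 0 := (mul_eq_zero.mp (by linarith : n * c 4 = 0)).resolve_left hn
      apply hc
      funext i
      fin_cases i
      · exact hc0
      · simpa [hc0] using hc1
      · exact hc2
      · simpa [hc2] using hc3
      · exact hc4
      · simpa [hc4] using hc5
  · have ha0 : a 0 = 0 := by nlinarith [sq_nonneg (a 0), sq_nonneg (a 2), sq_nonneg (a 4)]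
    have ha2 : a 2 = 0 := by nlinarith [sq_nonneg (a 0), sq_nonneg (a 2), sq_nonneg (a 4)]
    have ha4 : a 4 = 0 := by nlinarith [sq_nonneg (a 0), sq_nonneg (a 2), sq_nonneg (a 4)]
    exact ha (funext fun i => by fin_cases i <;> assumption)

/-- **No homological obstruction once some `kᵢ ≥ 1`** (AZ25 §7 case (1)).  If `L_γ` is closed
under `ℤ`-linear combinations and contains two independent classes `x, y` (it has rank `3`), then
any nonzero class `a ∈ L_α ∩ L_β` (one exists iff the sector bounded by `H_α ∪ H_β ≅ #ᵏ S¹×S²`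
has `k ≥ 1`) yields a shadow triple `(a, a, c)` with `c := ⟪a,y⟫ x − ⟪a,x⟫ y ∈ L_γ ∩ a^⟂`, or
`c := x` when `a ⟂ x, y` already.  By the symmetry of the three handlebodies the same holds for
any pair; for a homotopy 4-sphere `Σ kᵢ = 3`, so some pair always qualifies. [folklore] -/
theorem shadowTriple_of_common_class (Lα Lβ Lγ : Set (Fin 6 → ℤ))
    (hγ : ∀ x ∈ Lγ, ∀ y ∈ Lγ, ∀ s t : ℤ, s • x + t • y ∈ Lγ)
    {a : Fin 6 → ℤ} (haα : a ∈ Lα) (haβ : a ∈ Lβ) (ha : a ≠ 0)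
    {x y : Fin 6 → ℤ} (hx : x ∈ Lγ) (hy : y ∈ Lγ)
    (hxy : ∀ s t : ℤ, s • x + t • y = 0 → s = 0 ∧ t = 0) :
    ∃ a' ∈ Lα, ∃ b ∈ Lβ, ∃ c ∈ Lγ, a' ≠ 0 ∧ b ≠ 0 ∧ c ≠ 0 ∧
      a' 0 * b 1 - a' 1 * b 0 + (a' 2 * b 3 - a' 3 * b 2) + (a' 4 * b 5 - a' 5 * b 4) = 0 ∧
      b 0 * c 1 - b 1 * c 0 + (b 2 * c 3 - b 3 * c 2) + (b 4 * c 5 - b 5 * c 4) = 0 ∧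
      a' 0 * c 1 - a' 1 * c 0 + (a' 2 * c 3 - a' 3 * c 2) + (a' 4 * c 5 - a' 5 * c 4) = 0 ∧
      ∃ l m n : ℤ, ¬ (l = 0 ∧ m = 0 ∧ n = 0) ∧ l • a' + m • b + n • c = 0 := by
  have hself : a 0 * a 1 - a 1 * a 0 + (a 2 * a 3 - a 3 * a 2) + (a 4 * a 5 - a 5 * a 4) = 0 := by
    ring
  -- the two pairings `⟪a, x⟫`, `⟪a, y⟫`
  set p : ℤ := a 0 * x 1 - a 1 * x 0 + (a 2 * x 3 - a 3 * x 2) + (a 4 * x 5 - a 5 * x 4) with hp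
  set q : ℤ := a 0 * y 1 - a 1 * y 0 + (a 2 * y 3 - a 3 * y 2) + (a 4 * y 5 - a 5 * y 4) with hq
  have hlin : ∀ s t : ℤ,
      a 0 * (s • x + t • y) 1 - a 1 * (s • x + t • y) 0 +
        (a 2 * (s • x + t • y) 3 - a 3 * (s • x + t • y) 2) +
        (a 4 * (s • x + t • y) 5 - a 5 * (s • x + t • y) 4) = s * p + t * q := fun s t => by
    simp only [hp, hq, Pi.add_apply, Pi.smul_apply, smul_eq_mul]; ring
  have hx0 : x ≠ 0 := by
    intro hx0
    exact one_ne_zero (hxy 1 0 (by simp [hx0])).1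
  by_cases hzero : p = 0 ∧ q = 0
  · refine ⟨a, haα, a, haβ, x, hx, ha, ha, hx0, hself, ?_, ?_, 1, -1, 0, by simp, by simp⟩
    · simpa [hp] using hzero.1
    · simpa [hp] using hzero.1
  · set c : Fin 6 → ℤ := q • x + (-p) • y with hc_def
    have hc : c ∈ Lγ := hγ x hx y hy _ _
    have hc0 : c ≠ 0 := by
      intro h0
      obtain ⟨h1, h2⟩ := hxy _ _ h0
      exact hzero ⟨neg_eq_zero.mp h2, h1⟩
    have hac : a 0 * c 1 - a 1 * c 0 + (a 2 * c 3 - a 3 * c 2) + (a 4 * c 5 - a 5 * c 4) = 0 := by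
      rw [hc_def, hlin]; ring
    exact ⟨a, haα, a, haβ, c, hc, ha, ha, hc0, hself, hac, hac, 1, -1, 0, by simp, by simp⟩

/-- **The instance for the standard `(3;1,1,1)` trisection of `S⁴`** (sum of the three
unbalanced genus-`1` stabilisations: on the first torus `α ∥ β`, on the second `β ∥ γ`, on the
third `γ ∥ α`): `L_α = {a | a₁ = a₂ = a₅ = 0}`, `L_β = {b | b₁ = b₃ = b₄ = 0}`,
`L_γ = {c | c₀ = c₃ = c₅ = 0}` (pairwise intersections of rank `1`, sum `ℤ⁶`); the shadow triple
produced is `(e₀, e₀, −e₂)` (the `α = β` curve of the first torus twice, the `β = γ` curve of the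
second).  Homology does not object to a dependent triple in the algebraic type of a
homotopy sphere. [folklore] -/
theorem shadowTriple_sphere_threeOneOneOne :
    ∃ a ∈ {a : Fin 6 → ℤ | a 1 = 0 ∧ a 2 = 0 ∧ a 5 = 0},
      ∃ b ∈ {b : Fin 6 → ℤ | b 1 = 0 ∧ b 3 = 0 ∧ b 4 = 0},
        ∃ c ∈ {c : Fin 6 → ℤ | c 0 = 0 ∧ c 3 = 0 ∧ c 5 = 0}, a ≠ 0 ∧ b ≠ 0 ∧ c ≠ 0 ∧
          a 0 * b 1 - a 1 * b 0 + (a 2 * b 3 - a 3 * b 2) + (a 4 * b 5 - a 5 * b 4) = 0 ∧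
          b 0 * c 1 - b 1 * c 0 + (b 2 * c 3 - b 3 * c 2) + (b 4 * c 5 - b 5 * c 4) = 0 ∧
          a 0 * c 1 - a 1 * c 0 + (a 2 * c 3 - a 3 * c 2) + (a 4 * c 5 - a 5 * c 4) = 0 ∧
          ∃ l m n : ℤ, ¬ (l = 0 ∧ m = 0 ∧ n = 0) ∧ l • a + m • b + n • c = 0 := by
  refine shadowTriple_of_common_class _ _ _ ?_ (a := Pi.single 0 1) (by simp) (by simp)
    (fun h => by simpa using congr_fun h 0) (x := Pi.single 1 1) (y := Pi.single 2 1)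
    (by simp) (by simp) ?_
  · rintro x ⟨hx0, hx3, hx5⟩ y ⟨hy0, hy3, hy5⟩ s t
    refine ⟨?_, ?_, ?_⟩ <;> simp [*]
  · intro s t h
    have h1 := congr_fun h 1
    have h2 := congr_fun h 2
    simp at h1 h2
    exact ⟨h1, h2⟩

end Summit.SmoothPoincare4.SmoothPoincare4.Theorems.DependentTripleAtThree.Negative
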